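import Mathlib
import HarnessLib
import Summits.Ventures.LatticeQCDFlow.Exactness.NCMCGeneralSpacePairMartingale
import Summits.Ventures.LatticeQCDFlow.Exactness.NCMCGeneralSpaceDoeblinPowerCLT

/-!
# The CLT for two-time averages `(1/n) Σ_{t<n} φ(X_t, X_{t+1})` (transition frequencies, empirical fluxes) under a Doeblin power, from every initial law

HONEST FRAMING: exact (Metropolis-corrected) sampling algorithms for lattice gauge theory;
figures of merit are autocorrelation/cost numbers at stated couplings and volumes; no
continuum-physics claim.

Venture `LatticeQCDFlow` (cell pub-lqcd), topic `Exactness`; FANOUT row 13 (`eng-snf`, GEN-19).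
NEW WORK of the cell, not a published result; no definition is introduced; nothing is cited as a
fact.  The two-time statistics of the cell — the NCMC lane's acceptance frequencies
`(1/n) Σ 1_prior(X_t) 1_target(X_{t+1})` (GEN-17/18 `acc_fwd`, `acc_rev`), rows 8/9's empirical exit
fluxes `(1/n) Σ 1_A(X_t) 1_{Aᶜ}(X_{t+1})` — are time averages of a bounded PAIR functional
`φ(X_t, X_{t+1})`.  Their law of large numbers is GEN-17's two-time Birkhoff; THIS file gives the
central limit theorem under a Doeblin power, by the martingale route of GEN-19: with
`m = ∫∫ φ(u, y) κ(u, dy) π(du)`, `f̄ = κφ − m` (a bounded centred ONE-variable observable) and `h` a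
bounded Poisson solution `h − κh = f̄` (`NCMCGeneralSpaceDoeblinPowerPoisson.poisson_exists_of_nHit`),
`φ(X_t, X_{t+1}) − m = D_t + h(X_t) − h(X_{t+1})` with the PAIR increment
`D_t = ψ(X_t, X_{t+1}) − (κψ)(X_t)`, `ψ(u, y) = φ(u, y) + h(y)` (`NCMCGeneralSpacePairMartingale`:
orthogonal to the past, squares obeying the LLN from every start); McLeish's CLT
(`NCMCGeneralSpaceMartingaleCLT`) and the `O(1/√n)` boundary term finish.

## Content (`κ` Markov on `S`, `π` invariant, `(nHit κ m)(z,·) ≥ ε ν` (`ε ≠ 0`, `0 < m`);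
## `φ : S × S → ℝ` measurable, `|φ| ≤ C`; `m_φ = ∫ (∫ φ(u,y) κ(u,dy)) π(du)`)

* `exists_poisson_pair_of_nHit` — a bounded measurable `h` with `h − κh = κφ − m_φ` exists.
* **`tendstoInDistribution_pairTimeAverage_of_nHit`** — THE THEOREM: for any such `h`, with
  `ψ(u,y) = φ(u,y) + h(y)` and `V = ∫ (∫ (ψ(u,y) − (κψ)(u))² κ(u,dy)) π(du)`, for EVERY initial law
  `μ₀` and every `Y ~ N(0, V)`:
  `TendstoInDistribution (fun n x => (√n)⁻¹ Σ_{t<n} (φ(x_t, x_{t+1}) − m_φ)) atTop Y (fun _ => P_{μ₀}) P'`.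

NOT CLAIMED: the Green–Kubo (autocovariance-series) form of `V` for pair functionals; ratios of
two-time and one-time averages (the acceptance RATES; their numerators and denominators are covered
separately); functionals of longer windows; unbounded `φ`.
-/

namespace Summit.Ventures.LatticeQCDFlow.Exactness.GeneralNCMC

open MeasureTheory ProbabilityTheory Set Filter Finset Preorder
open scoped ENNReal Topology

variable {S : Type*} [MeasurableSpace S]

section PairCLT

variable {κ : Kernel S S} [IsMarkovKernel κ] {π : Measure S} [IsProbabilityMeasure π]
  {ν : Measure S} [IsProbabilityMeasure ν] {ε : ℝ≥0∞} {m : ℕ}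

/-- **A bounded Poisson solution for the conditional mean of a pair functional**: under a Doeblin
power there is a bounded measurable `h` with `h − κh = κφ − m_φ`. -/
theorem exists_poisson_pair_of_nHit (hπ : Kernel.Invariant κ π) (hε : ε ≠ 0)
    (hmin : ∀ z, ε • ν ≤ nHit κ m z) (hm : 0 < m)
    {φ : S × S → ℝ} (hφ : Measurable φ) {C : ℝ} (hC : ∀ p, |φ p| ≤ C) :
    ∃ h : S → ℝ, Measurable h ∧ (∃ Ch : ℝ, ∀ x, |h x| ≤ Ch) ∧
      ∀ u, h u - Scoring.kop κ h u
        = (∫ y, φ (u, y) ∂(κ u)) - ∫ u', (∫ y, φ (u', y) ∂(κ u')) ∂π := by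
  haveI := isMarkovKernel_nHit κ m
  haveI : Nonempty S := ⟨Classical.choice (nonempty_of_isProbabilityMeasure π)⟩
  have hε1 : ε ≤ 1 := eps_le_one_of_minorised hmin
  have hε0 : 0 < ε := pos_iff_ne_zero.2 hε
  have hKm := measurable_kopPair κ hφ
  have hKb : ∀ u, |∫ y, φ (u, y) ∂(κ u)| ≤ C := abs_kopPair_le κ hC
  have hC0 : 0 ≤ C := (abs_nonneg _).trans (hKb (Classical.choice (nonempty_of_isProbabilityMeasure π)))
  -- the centred conditional mean
  have hmean : |∫ u', (∫ y, φ (u', y) ∂(κ u')) ∂π| ≤ C := by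
    rw [← Real.norm_eq_abs]
    calc _ ≤ C * π.real univ :=
          norm_integral_le_of_norm_le_const (Eventually.of_forall fun u => by
            rw [Real.norm_eq_abs]; exact hKb u)
      _ = C := by rw [probReal_univ, mul_one]
  have hfm : Measurable fun u => (∫ y, φ (u, y) ∂(κ u)) - ∫ u', (∫ y, φ (u', y) ∂(κ u')) ∂π :=
    hKm.sub measurable_const
  have hfC : ∀ u, |(∫ y, φ (u, y) ∂(κ u)) - ∫ u', (∫ y, φ (u', y) ∂(κ u')) ∂π| ≤ 2 * C := fun u =>
    (abs_sub _ _).trans ((add_le_add (hKb u) hmean).trans (by ring_nf; rfl))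
  have hf0 : ∫ u, ((∫ y, φ (u, y) ∂(κ u)) - ∫ u', (∫ y, φ (u', y) ∂(κ u')) ∂π) ∂π = 0 := by
    rw [integral_sub (Scoring.integrable_of_bounded π hKm hKb) (integrable_const _), integral_const,
      probReal_univ, one_smul, sub_self]
  obtain ⟨h, hhm, hhb, hpois⟩ := poisson_exists_of_nHit
    (fun x _ hB => minorised_setwise hmin x hB) hε0 hε1 hm hπ hfm hfC hf0
  exact ⟨h, hhm, ⟨_, hhb⟩, hpois⟩

/-- **THE CLT FOR TWO-TIME AVERAGES UNDER A DOEBLIN POWER, FROM ANY INITIAL LAW.**  `κ` Markov,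
`π` invariant, `(nHit κ m)(z,·) ≥ ε ν` (`ε ≠ 0`, `0 < m`); `φ : S × S → ℝ` measurable with `|φ| ≤ C`;
`m_φ = ∫ (∫ φ(u,y) κ(u,dy)) π(du)`; `h` bounded measurable with `h − κh = κφ − m_φ`;
`ψ(u,y) = φ(u,y) + h(y)`, `V = ∫ (∫ (ψ(u,y) − (κψ)(u))² κ(u,dy)) π(du)`.  For EVERY initial law
`μ₀` and every `Y ~ N(0, V)`:
`TendstoInDistribution (fun n x => (√n)⁻¹ Σ_{t<n} (φ(x_t, x_{t+1}) − m_φ)) atTop Y (fun _ => P_{μ₀}) P'`. -/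
theorem tendstoInDistribution_pairTimeAverage_of_nHit (hπ : Kernel.Invariant κ π) (hε : ε ≠ 0)
    (hmin : ∀ z, ε • ν ≤ nHit κ m z)
    {φ : S × S → ℝ} (hφ : Measurable φ) {C : ℝ} (hC : ∀ p, |φ p| ≤ C)
    {h : S → ℝ} (hh : Measurable h) {Ch : ℝ} (hCh : ∀ x, |h x| ≤ Ch)
    (hpois : ∀ u, h u - Scoring.kop κ h u
      = (∫ y, φ (u, y) ∂(κ u)) - ∫ u', (∫ y, φ (u', y) ∂(κ u')) ∂π)
    (μ₀ : Measure S) [IsProbabilityMeasure μ₀]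
    {Ω' : Type*} [MeasurableSpace Ω'] {P' : Measure Ω'} [IsProbabilityMeasure P'] {Y : Ω' → ℝ}
    (hY : HasLaw Y (gaussianReal 0 (Real.toNNReal
      (∫ u, (∫ y, ((φ (u, y) + h y) - ∫ y', (φ (u, y') + h y') ∂(κ u)) ^ 2 ∂(κ u)) ∂π))) P')
    [IsProbabilityMeasure (Kernel.trajMeasure (X := fun _ : ℕ => S) μ₀
        (fun n : ℕ => κ.comap (fun hh : (i : ↥(Finset.Iic n)) → S => hh ⟨n, Finset.mem_Iic.2 le_rfl⟩)
          (measurable_pi_apply _)))] :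
    TendstoInDistribution (fun (n : ℕ) (x : ℕ → S) =>
        (Real.sqrt n)⁻¹ * ∑ t ∈ Finset.range n,
          (φ (x t, x (t + 1)) - ∫ u', (∫ y, φ (u', y) ∂(κ u')) ∂π))
      atTop Y (fun _ => Kernel.trajMeasure (X := fun _ : ℕ => S) μ₀
        (fun n : ℕ => κ.comap (fun hh : (i : ↥(Finset.Iic n)) → S => hh ⟨n, Finset.mem_Iic.2 le_rfl⟩)
          (measurable_pi_apply _))) P' := by
  set P := Kernel.trajMeasure (X := fun _ : ℕ => S) μ₀
    (fun n : ℕ => κ.comap (fun hh : (i : ↥(Finset.Iic n)) → S => hh ⟨n, Finset.mem_Iic.2 le_rfl⟩)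
      (measurable_pi_apply _)) with hP
  set mφ : ℝ := ∫ u', (∫ y, φ (u', y) ∂(κ u')) ∂π with hmφ
  -- the pair observable `ψ = φ + h ∘ snd`
  set ψ : S × S → ℝ := fun p => φ p + h p.2 with hψ
  have hψm : Measurable ψ := hφ.add (hh.comp measurable_snd)
  have hψC : ∀ p, |ψ p| ≤ C + Ch := fun p => (abs_add_le _ _).trans (add_le_add (hC p) (hCh p.2))
  have hKψb : ∀ u, |∫ y, ψ (u, y) ∂(κ u)| ≤ C + Ch := abs_kopPair_le κ hψC
  -- the increments
  set D : ℕ → (ℕ → S) → ℝ := fun t x => ψ (x t, x (t + 1)) - ∫ y, ψ (x t, y) ∂(κ (x t)) with hD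
  have hKψm := measurable_kopPair κ hψm
  have hDm : ∀ t, Measurable (D t) := fun t =>
    (hψm.comp ((measurable_pi_apply t).prodMk (measurable_pi_apply (t + 1)))).sub
      (hKψm.comp (measurable_pi_apply t))
  have hDb : ∀ t x, |D t x| ≤ 2 * (C + Ch) := fun t x => abs_pairIncrement_le κ hψC x t
  have horth : ∀ (n : ℕ) (F : (Fin n → ℝ) → ℝ) (K : ℝ), Measurable F → (∀ v, |F v| ≤ K) →
      ∫ x, F (fun i => D i x) * D n x ∂P = 0 := fun n F K hF hK => by
    rw [hP]
    exact chain_pairIncrement_orthogonal κ μ₀ hψm hψC n F K hF hK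
  -- the quadratic variation from every start
  set V : ℝ := ∫ u, (∫ y, (ψ (u, y) - ∫ y', ψ (u, y') ∂(κ u)) ^ 2 ∂(κ u)) ∂π with hV
  have hQV : ∀ᵐ x ∂P, Tendsto (fun n : ℕ => (∑ t ∈ range n, D t x ^ 2) / n) atTop (𝓝 V) := by
    rw [hP]
    exact chain_pairIncrementSq_anyLaw_of_nHit hπ hε hmin hψm hψC μ₀
  have hV0 : 0 ≤ V := integral_nonneg fun u => integral_nonneg fun y => sq_nonneg _
  have hY' : HasLaw Y (gaussianReal 0 V.toNNReal) P' := hY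
  -- McLeish
  have hclt := tendstoInDistribution_sum_div_sqrt_of_orthogonal (P := P) hDm hDb horth hV0 hQV hY'
  -- the telescoping: `φ(x_t, x_{t+1}) − m_φ = D_t + h(x_t) − h(x_{t+1})`
  have hsplit : ∀ u, ∫ y, ψ (u, y) ∂(κ u) = (∫ y, φ (u, y) ∂(κ u)) + Scoring.kop κ h u := by
    intro u
    show ∫ y, (φ (u, y) + h y) ∂(κ u) = _
    rw [integral_add (Scoring.integrable_of_bounded _ (show Measurable fun y => φ (u, y) from
      hφ.comp measurable_prodMk_left) (fun y => hC (u, y))) (Scoring.integrable_of_bounded _ hh hCh)]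
    rfl
  have hpt : ∀ (x : ℕ → S) (t : ℕ), φ (x t, x (t + 1)) - mφ = D t x + (h (x t) - h (x (t + 1))) := by
    intro x t
    have hp := hpois (x t)
    rw [hD]
    dsimp only
    rw [hsplit (x t)]
    show φ (x t, x (t + 1)) - mφ = φ (x t, x (t + 1)) + h (x (t + 1))
      - ((∫ y, φ (x t, y) ∂(κ (x t))) + Scoring.kop κ h (x t)) + (h (x t) - h (x (t + 1)))
    linarith
  have hsum : ∀ (x : ℕ → S) (n : ℕ), ∑ t ∈ range n, (φ (x t, x (t + 1)) - mφ)
      = (∑ t ∈ range n, D t x) + (h (x 0) - h (x n)) := by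
    intro x n
    simp_rw [hpt x]
    rw [Finset.sum_add_distrib, Finset.sum_range_sub' (fun t => h (x t)) n]
  -- transfer along the `O(1/√n)` boundary term
  have hYm : ∀ n : ℕ, Measurable fun x : ℕ → S =>
      (Real.sqrt n)⁻¹ * ∑ t ∈ Finset.range n, (φ (x t, x (t + 1)) - mφ) := fun n =>
    measurable_const.mul (Finset.measurable_sum _ fun t _ =>
      (hφ.comp ((measurable_pi_apply t).prodMk (measurable_pi_apply (t + 1)))).sub measurable_const)
  refine tendstoInDistribution_of_tendstoInMeasure_sub
    (X := fun (n : ℕ) (x : ℕ → S) => (Real.sqrt n)⁻¹ * ∑ t ∈ range n, D t x) _ Y hclt ?_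
    (fun n => (hYm n).aemeasurable)
  have hdiff : ∀ (n : ℕ) (x : ℕ → S),
      ((fun (n : ℕ) (x : ℕ → S) => (Real.sqrt n)⁻¹ * ∑ t ∈ Finset.range n, (φ (x t, x (t + 1)) - mφ))
        - fun (n : ℕ) (x : ℕ → S) => (Real.sqrt n)⁻¹ * ∑ t ∈ range n, D t x) n x
        = (Real.sqrt n)⁻¹ * (h (x 0) - h (x n)) := by
    intro n x
    simp only [Pi.sub_apply]
    rw [← mul_sub, hsum x n]
    ring
  have hDm' : ∀ n : ℕ, Measurable fun x : ℕ → S => (Real.sqrt n)⁻¹ * ∑ t ∈ range n, D t x := fun n =>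
    measurable_const.mul (Finset.measurable_sum _ fun t _ => hDm t)
  refine tendstoInMeasure_of_tendsto_ae (fun n => ((hYm n).sub (hDm' n)).aestronglyMeasurable)
    (ae_of_all _ fun x => ?_)
  simp_rw [hdiff]
  have h0 : Tendsto (fun n : ℕ => (Real.sqrt n)⁻¹ * (2 * Ch)) atTop (𝓝 0) := by
    have := (tendsto_inv_atTop_zero.comp
      (Real.tendsto_sqrt_atTop.comp tendsto_natCast_atTop_atTop)).mul_const (2 * Ch)
    simpa using this
  refine squeeze_zero_norm (fun n => ?_) h0
  rw [Real.norm_eq_abs, abs_mul, abs_inv, abs_of_nonneg (Real.sqrt_nonneg _)]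
  refine mul_le_mul_of_nonneg_left ?_ (inv_nonneg.2 (Real.sqrt_nonneg _))
  calc |h (x 0) - h (x n)| ≤ |h (x 0)| + |h (x n)| := abs_sub _ _
    _ ≤ Ch + Ch := add_le_add (hCh _) (hCh _)
    _ = 2 * Ch := by ring

end PairCLT

end Summit.Ventures.LatticeQCDFlow.Exactness.GeneralNCMC
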